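import Literature.NumberTheory.Sieve.HeathBrownPrincipalEstimate
import Literature.NumberTheory.Sieve.HeathBrownSSumLemma1
import HarnessLib

/-!
# Fouvry–Tenenbaum Lemma 4.13 (`θ = 1/2 + 1/85`) from Deligne's `K₂` bound and Birch–Bombieri

Sources: É. Fouvry, G. Tenenbaum, *Multiplicative functions in large arithmetic progressions and
applications*, Trans. AMS (2021), Lemma 4.13 [cite: FouvryTenenbaum2021]; D. R. Heath-Brown, *The divisor
function `d₃(n)` in arithmetic progressions*, Acta Arith. 47 (1986) [cite: HeathBrown1986d3].

`FouvryTenenbaum2021_lemma413_of_deligne_birchBombieri`: the named fact `FouvryTenenbaum2021_lemma413`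
(Heath-Brown's theorem in the form used by Fouvry–Tenenbaum, level `x^{1/2 + 1/85}`) follows from exactly
two inputs that are consequences of Deligne's theorem and are NOT in the tree:

* `hD` — Deligne's bound for the nondegenerate hyper-Kloosterman sum at primes,
  `|K₂(a₁, a₂, a₃; p)| ≤ 3p` for `p ∤ a₁a₂a₃` [Deligne, SGA 4½; HB (3.1) via Smith];
* `hBB` — the Birch–Bombieri bound `|S'(α, β; p)| ≤ C p^{3/2}` for `p ∤ αβ` (appendix to HB's [10]).

Everything else (HB §§2–7: Lemmas 2, 3, 4, 5, 7, the level-`1/2` estimate, and §7's combination) is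
proved in `HeathBrownSSum`, `HeathBrownSSumLemma4`, `HeathBrownSSumLemma1`,
`HeathBrownPrincipalEstimateTools/Core`, `HeathBrownPrincipalEstimate`, `TernaryDivisorAP*`,
`FouvryTenenbaumDivisorAPProofs`.  No named facts are introduced here.
-/

namespace Literature.NumberTheory.Sieve

namespace HeathBrown1986

/-- `L4B(q; ·) = q^{5/2} · L4shape(q; ·)`. [cite: HeathBrown1986d3, Lemma 4] -/
theorem L4B_eq_mul_L4shape (q : ℕ) (k t₁ t₂ ρ σ : ℤ) :
    L4B q k t₁ t₂ ρ σ = (q : ℝ) ^ (5 / 2 : ℝ) * L4shape q k t₁ t₂ ρ σ := by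
  rw [L4B_def]; unfold L4shape; ring

/-- **The Lemma-4-type bound at all moduli from Birch–Bombieri** (the input `hL4all` of
`lemma413_of_L4all_deligne`, with `C_L = 1`, `c_L = log₂ max(C+3, 96)`). [cite: HeathBrown1986d3, Lemma 4] -/
theorem L4all_of_BB {C : ℝ} (hC : 0 ≤ C)
    (hBB : ∀ (p : ℕ) [Fact p.Prime] (α β : ZMod p), α ≠ 0 → β ≠ 0 → ‖BBsum p α β‖ ≤ C * (p : ℝ) ^ (3 / 2 : ℝ))
    (s : ℕ) [NeZero s] (k t₁ t₂ ρ σ : ℤ) :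
    ‖SS s (k : ZMod s) (t₁ : ZMod s) (t₂ : ZMod s) (ρ : ZMod s) (σ : ZMod s)‖ ≤
      1 * ((Nat.divisors s).card : ℝ) ^ (Real.logb 2 (max (C + 3) 96)) * (s : ℝ) ^ (5 / 2 : ℝ) *
        L4shape s k t₁ t₂ ρ σ := by
  have h := norm_SS_le_dA_L4B_of_BB hC hBB s k t₁ t₂ ρ σ
  rw [L4B_eq_mul_L4shape] at h
  calc _ ≤ _ := h
    _ = _ := by ring

end HeathBrown1986

open HeathBrown1986 in
/-- **Fouvry–Tenenbaum's Lemma 4.13 at the printed level `θ = 1/2 + 1/85`, conditionally on Deligne's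
prime bound for `K₂` and the Birch–Bombieri bound** — i.e. Heath-Brown's theorem [HB86, Thm 1 / §7] in the
normalisation of [FT21, Lemma 4.13], with every step of Heath-Brown's paper formalized except the two
appeals to Deligne's theorem, which enter as the hypotheses `hD` ((3.1) at primes) and `hBB` (Lemma 1's
input). [cite: FouvryTenenbaum2021, Lemma 4.13] [cite: HeathBrown1986d3, §7] -/
theorem FouvryTenenbaum2021_lemma413_of_deligne_birchBombieri
    (hD : ∀ (p : ℕ) [Fact p.Prime] (a₁ a₂ a₃ : ZMod p), a₁ ≠ 0 → a₂ ≠ 0 → a₃ ≠ 0 →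
      ‖HeathBrown1986.K2 p a₁ a₂ a₃‖ ≤ 3 * p)
    {C : ℝ} (hC : 0 ≤ C)
    (hBB : ∀ (p : ℕ) [Fact p.Prime] (α β : ZMod p), α ≠ 0 → β ≠ 0 →
      ‖HeathBrown1986.BBsum p α β‖ ≤ C * (p : ℝ) ^ (3 / 2 : ℝ)) :
    FouvryTenenbaum2021_lemma413 :=
  lemma413_of_L4all_deligne zero_le_one
    (Real.logb_nonneg one_lt_two (le_trans (by norm_num) (le_max_right _ _))) (L4all_of_BB hC hBB) hD

end Literature.NumberTheory.Sieve
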